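import Summits.NavierStokesRegularity.OSWSelfSimilar.SheetRCertificateAssembly
import Summits.NavierStokesRegularity.OSWSelfSimilar.SheetRCayleyHilbert
import Summits.NavierStokesRegularity.OSWSelfSimilar.SheetRFarFieldT2
import Literature.Analysis.Fourier.HilbertTransformLineSplit
import HarnessLib

/-!
# SHEET-ℝ frame: a finite FRAME combination `Σ dₙ·(1 + cos θ)sin nθ + α·L²T₂` IS a centre (`IsCentre`) — the typed form of the
# certificate's centre of record

HONEST FRAMING (cell ns-blowup GROUP B / zone Z3, cases Z3-SR-CERT / Z3-SR-SPEC; 1-D MODEL certificate frame; not Euler/NS; «violates: none —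
MODEL»).  The CENTRE of record of the sheet-ℝ certificate (cert-1 impl-1 `centre_L8_refit_rational.json` c4de65e13d80c930: `Σ_{k≤768} b_k sin kθ +
α₂·L²T₂`, `θ = 2arctan(ξ/L)`, `L = 8`, exact cancellation `Σ(−1)^k k b_k = 0`) enters every kernel theorem of the Z3-SR chain as the HYPOTHESIS
`hc : IsCentre L Ω̄ Ω̄₁ H₀` (hypothesis-ledger rows #1/#2: «the centre is not a Lean object»).  By the cancellation the sine sum lies in the span of
the FRAME `e_n = (1 + cos θ) sin nθ`, whose calculus the tree has mode by mode (`SheetRCayleySubstitution`, `SheetRCayleyHilbert.hilbertTransform_frame`,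
`SheetRFarFieldT2`).  For EVERY `L > 0`, `N`, `d : ℕ → ℝ`, `α : ℝ` this file gives `frameCentre L N d α = Σ_{i<N} d_i e_{i+1} + α·L²·T₂` with explicit
derivative `frameCentreDeriv` (both smooth, odd, `|Ω|, |Ω₁| ≤ C/(L² + ξ²)`), the closed form `HΩ = −Σ d_i(1 + cos θ)cos((i+1)θ) + αL²·HT₂`
(additivity of the p.v. transform on `C¹ ∩ L¹` summands), and **`isCentre_frameCentre`**: `IsCentre L Ω Ω₁ (2Σ|d_i| + 6|α|/π)`; plus
`contDiff_frameCentreDeriv` (row #2).  The instantiation at the 767 frame coefficients of record (exact dyadic rationals, re-encoded OFFLINE from the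
sine coefficients by `b_k = d_k + ½(d_{k−1} + d_{k+1})`) is the data file `SheetRCentreOfRecord.lean`.  Definitions are explicit closed-form functions;
no named fact.  WHAT THIS IS NOT: not NS; no certificate sentence ((C1), (S1), residual) is proved — those remain interval arithmetic ABOUT this
now-typed object.
-/

noncomputable section

namespace Summit.NavierStokesRegularity.OSWSelfSimilar
namespace SheetRFrameCentre

open _root_.MeasureTheory _root_.Set _root_.Filter _root_.Real Literature.Analysis.Fourier SheetRCayleySubstitution SheetRCayleyHilbert
  SheetRFarFieldT2 SheetRCertificateAssembly
open scoped Topology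

/-! ### §1 The frame functions and their derivatives -/

/-- The frame function `e_n(ξ) = (1 + cos θ)·sin nθ`, `θ = 2arctan(ξ/L)`. [folklore] -/
def frame (L : ℝ) (n : ℕ) (ξ : ℝ) : ℝ := (1 + cos (2 * arctan (ξ / L))) * sin (n * (2 * arctan (ξ / L)))

/-- Its derivative `e_n′(ξ) = [−sin θ·sin nθ + n(1 + cos θ)cos nθ]·θ′`, `θ′ = 2L/(L² + ξ²)`. [folklore] -/
def frameDeriv (L : ℝ) (n : ℕ) (ξ : ℝ) : ℝ :=
  (-sin (2 * arctan (ξ / L)) * sin (n * (2 * arctan (ξ / L)))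
    + n * ((1 + cos (2 * arctan (ξ / L))) * cos (n * (2 * arctan (ξ / L))))) * (2 * L / (L ^ 2 + ξ ^ 2))

/-- `e_n′` is the derivative of `e_n`. [folklore] -/
theorem hasDerivAt_frame {L : ℝ} (hL : L ≠ 0) (n : ℕ) (ξ : ℝ) : HasDerivAt (frame L n) (frameDeriv L n ξ) ξ := by
  have hθ := hasDerivAt_cayleyAngle hL ξ
  have h1 : HasDerivAt (fun ξ => 1 + cos (2 * arctan (ξ / L))) (-sin (2 * arctan (ξ / L)) * (2 * L / (L ^ 2 + ξ ^ 2))) ξ := by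
    simpa using ((Real.hasDerivAt_cos _).comp ξ hθ).const_add 1
  have h2 : HasDerivAt (fun ξ => sin (n * (2 * arctan (ξ / L)))) (cos (n * (2 * arctan (ξ / L))) * (n * (2 * L / (L ^ 2 + ξ ^ 2)))) ξ :=
    (Real.hasDerivAt_sin _).comp ξ (hθ.const_mul (n : ℝ))
  refine (h1.mul h2).congr_deriv ?_
  simp only [frameDeriv]
  ring

/-- `|e_n(ξ)| ≤ 2L²/(L² + ξ²)`. [folklore] -/
theorem abs_frame_le' {L : ℝ} (hL : L ≠ 0) (n : ℕ) (ξ : ℝ) : |frame L n ξ| ≤ 2 * L ^ 2 / (L ^ 2 + ξ ^ 2) :=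
  abs_frame_le hL n ξ

/-- `|e_n′(ξ)| ≤ (2n + 1)·2|L|/(L² + ξ²)`. [folklore] -/
theorem abs_frameDeriv_le {L : ℝ} (hL : L ≠ 0) (n : ℕ) (ξ : ℝ) : |frameDeriv L n ξ| ≤ (2 * n + 1) * (2 * |L| / (L ^ 2 + ξ ^ 2)) := by
  rw [frameDeriv, abs_mul]
  have hL2 : 0 < L ^ 2 := by positivity
  have hw : 0 < L ^ 2 + ξ ^ 2 := by positivity
  have hθ' : |2 * L / (L ^ 2 + ξ ^ 2)| = 2 * |L| / (L ^ 2 + ξ ^ 2) := by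
    rw [abs_div, abs_of_pos hw, abs_mul, abs_two]
  rw [hθ']
  refine mul_le_mul_of_nonneg_right ?_ (by positivity)
  have hc : |1 + cos (2 * arctan (ξ / L))| ≤ 2 := by
    rw [abs_le]; constructor <;> linarith [neg_one_le_cos (2 * arctan (ξ / L)), cos_le_one (2 * arctan (ξ / L))]
  calc |(-sin (2 * arctan (ξ / L)) * sin (n * (2 * arctan (ξ / L)))
          + n * ((1 + cos (2 * arctan (ξ / L))) * cos (n * (2 * arctan (ξ / L)))))|
      ≤ |(-sin (2 * arctan (ξ / L)) * sin (n * (2 * arctan (ξ / L))))|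
          + |n * ((1 + cos (2 * arctan (ξ / L))) * cos (n * (2 * arctan (ξ / L))))| := abs_add_le _ _
    _ ≤ 1 + n * 2 := by
        refine add_le_add ?_ ?_
        · rw [abs_mul, abs_neg]
          exact mul_le_one₀ (abs_sin_le_one _) (abs_nonneg _) (abs_sin_le_one _)
        · rw [abs_mul, Nat.abs_cast, abs_mul]
          have h12 : |1 + cos (2 * arctan (ξ / L))| * |cos (↑n * (2 * arctan (ξ / L)))| ≤ 2 * 1 :=
            mul_le_mul hc (abs_cos_le_one _) (abs_nonneg _) zero_le_two
          rw [mul_one] at h12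
          exact mul_le_mul_of_nonneg_left h12 n.cast_nonneg
    _ = 2 * n + 1 := by ring

/-- `e_n` is odd. [folklore] -/
theorem frame_neg' (L : ℝ) (n : ℕ) (ξ : ℝ) : frame L n (-ξ) = -frame L n ξ := by
  simp only [frame]
  have h := frame_neg L n ξ
  rwa [neg_div] at h ⊢

/-- `e_n` is smooth. [folklore] -/
theorem contDiff_frame' (L : ℝ) (n : ℕ) {k : WithTop ℕ∞} : ContDiff ℝ k (frame L n) := contDiff_frame L n

/-- `e_n′` is smooth. [folklore] -/
theorem contDiff_frameDeriv {L : ℝ} (hL : L ≠ 0) (n : ℕ) {k : WithTop ℕ∞} : ContDiff ℝ k (frameDeriv L n) := by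
  have hL2 : 0 < L ^ 2 := by positivity
  have hθ : ContDiff ℝ k fun ξ : ℝ => 2 * arctan (ξ / L) := contDiff_const.mul (contDiff_arctan.comp (contDiff_id.div_const L))
  have hw : ContDiff ℝ k fun ξ : ℝ => 2 * L / (L ^ 2 + ξ ^ 2) := contDiff_const.div (by fun_prop) fun ξ => by positivity
  unfold frameDeriv
  exact (((Real.contDiff_sin.comp hθ).neg.mul (Real.contDiff_sin.comp (contDiff_const.mul hθ))).add
    (contDiff_const.mul ((contDiff_const.add (Real.contDiff_cos.comp hθ)).mul (Real.contDiff_cos.comp (contDiff_const.mul hθ))))).mul hw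

/-! ### §2 The far-field shape `T₂` and its derivative -/

/-- `S(s) = s·((1 + s²)√(1 + s²))⁻¹` (`T₂` at `L = 1`). [folklore] -/
def shapeS (s : ℝ) : ℝ := s / ((1 + s ^ 2) * √(1 + s ^ 2))

/-- `S′(s) = (1 − 2s²)/((1 + s²)²√(1 + s²))`. [folklore] -/
def shapeSDeriv (s : ℝ) : ℝ := (1 - 2 * s ^ 2) / ((1 + s ^ 2) ^ 2 * √(1 + s ^ 2))

/-- `T₂(ξ) = ξ·((L² + ξ²)√(L² + ξ²))⁻¹` (the tree's spelling in `SheetRFarFieldT2`). [folklore] -/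
def farT2 (L ξ : ℝ) : ℝ := ξ / ((L ^ 2 + ξ ^ 2) * √(L ^ 2 + ξ ^ 2))

/-- `T₂′(ξ) = L⁻²·S′(ξ/L)/L`. [folklore] -/
def farT2Deriv (L ξ : ℝ) : ℝ := (L ^ 2)⁻¹ * (shapeSDeriv (ξ / L) / L)

/-- `T₂ = L⁻²·S(·/L)`. [folklore] -/
theorem farT2_eq {L : ℝ} (hL : 0 < L) (ξ : ℝ) : farT2 L ξ = (L ^ 2)⁻¹ * shapeS (ξ / L) := farFieldT2_scale hL ξ

/-- `T₂′` is the derivative of `T₂`. [folklore] -/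
theorem hasDerivAt_farT2 {L : ℝ} (hL : 0 < L) (ξ : ℝ) : HasDerivAt (farT2 L) (farT2Deriv L ξ) ξ := by
  have hfun : farT2 L = fun ξ => (L ^ 2)⁻¹ * shapeS (ξ / L) := funext (farT2_eq hL)
  rw [hfun]
  have hS : HasDerivAt shapeS (shapeSDeriv (ξ / L)) (ξ / L) := hasDerivAt_farFieldT2_one (ξ / L)
  have hdiv : HasDerivAt (fun ξ : ℝ => ξ / L) (1 / L) ξ := by simpa using (hasDerivAt_id ξ).div_const L
  have h := (hS.comp ξ hdiv).const_mul ((L ^ 2)⁻¹)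
  refine h.congr_deriv ?_
  rw [farT2Deriv]; ring

/-- `|S′(s)| ≤ 2/(1 + s²)`. [folklore] -/
theorem abs_shapeSDeriv_le (s : ℝ) : |shapeSDeriv s| ≤ 2 / (1 + s ^ 2) := by
  rw [shapeSDeriv, abs_div, abs_of_pos (by positivity : (0:ℝ) < (1 + s ^ 2) ^ 2 * √(1 + s ^ 2)),
    div_le_div_iff₀ (by positivity) (by positivity)]
  have hs1 : 1 ≤ √(1 + s ^ 2) := Literature.Analysis.SpecialFunctions.one_le_sqrt_one_add_sq s
  have h1 : |1 - 2 * s ^ 2| ≤ 2 * (1 + s ^ 2) := by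
    rw [abs_le]; constructor <;> nlinarith [sq_nonneg s]
  calc |1 - 2 * s ^ 2| * (1 + s ^ 2) ≤ 2 * (1 + s ^ 2) * (1 + s ^ 2) := by gcongr
    _ = 2 * ((1 + s ^ 2) ^ 2 * 1) := by ring
    _ ≤ 2 * ((1 + s ^ 2) ^ 2 * √(1 + s ^ 2)) := by gcongr

/-- `|L²·T₂(ξ)| ≤ L²/(L² + ξ²)`. [folklore] -/
theorem abs_farT2_le {L : ℝ} (hL : 0 < L) (ξ : ℝ) : |L ^ 2 * farT2 L ξ| ≤ L ^ 2 / (L ^ 2 + ξ ^ 2) := by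
  rw [abs_mul, abs_of_pos (by positivity : (0:ℝ) < L ^ 2), div_eq_mul_inv]
  exact mul_le_mul_of_nonneg_left (abs_farFieldT2_le hL ξ) (by positivity)

/-- `|L²·T₂′(ξ)| ≤ 2L/(L² + ξ²)`. [folklore] -/
theorem abs_farT2Deriv_le {L : ℝ} (hL : 0 < L) (ξ : ℝ) : |L ^ 2 * farT2Deriv L ξ| ≤ 2 * L / (L ^ 2 + ξ ^ 2) := by
  have hL0 : L ≠ 0 := hL.ne'
  rw [farT2Deriv, ← mul_assoc, mul_inv_cancel₀ (pow_ne_zero 2 hL0), one_mul, abs_div, abs_of_pos hL,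
    div_le_div_iff₀ hL (by positivity)]
  have h := abs_shapeSDeriv_le (ξ / L)
  have hs : 1 + (ξ / L) ^ 2 = (L ^ 2 + ξ ^ 2) / L ^ 2 := by field_simp
  rw [hs, div_div_eq_mul_div] at h
  calc |shapeSDeriv (ξ / L)| * (L ^ 2 + ξ ^ 2) ≤ 2 * L ^ 2 / (L ^ 2 + ξ ^ 2) * (L ^ 2 + ξ ^ 2) := by gcongr
    _ = 2 * L * L := by field_simp

/-- `T₂` is odd. [folklore] -/
theorem farT2_neg (L ξ : ℝ) : farT2 L (-ξ) = -farT2 L ξ := by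
  simp only [farT2, neg_sq, neg_div]

/-- `T₂` is smooth. [folklore] -/
theorem contDiff_farT2 {L : ℝ} (hL : 0 < L) {k : WithTop ℕ∞} : ContDiff ℝ k (farT2 L) := contDiff_farFieldT2 hL

/-- `T₂′` is smooth. [folklore] -/
theorem contDiff_farT2Deriv (L : ℝ) {k : WithTop ℕ∞} : ContDiff ℝ k (farT2Deriv L) := by
  have h1 : ContDiff ℝ k fun s : ℝ => 1 + s ^ 2 := by fun_prop
  have hS : ContDiff ℝ k shapeSDeriv := by
    unfold shapeSDeriv
    exact (contDiff_const.sub (contDiff_const.mul (contDiff_id.pow 2))).div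
      ((h1.pow 2).mul (h1.sqrt fun x => by positivity)) fun x => by positivity
  unfold farT2Deriv
  exact contDiff_const.mul ((hS.comp (contDiff_id.div_const L)).div_const L)

/-! ### §3 The frame centre, its derivative, the pointwise bounds -/

/-- **The frame centre** `Ω(ξ) = Σ_{i<N} d_i·e_{i+1}(ξ) + α·L²·T₂(ξ)`. [folklore] -/
def frameCentre (L : ℝ) (N : ℕ) (d : ℕ → ℝ) (α : ℝ) (ξ : ℝ) : ℝ :=
  (∑ i ∈ Finset.range N, d i * frame L (i + 1) ξ) + α * (L ^ 2 * farT2 L ξ)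

/-- Its derivative `Ω₁ = Σ d_i·e_{i+1}′ + α·L²·T₂′`. [folklore] -/
def frameCentreDeriv (L : ℝ) (N : ℕ) (d : ℕ → ℝ) (α : ℝ) (ξ : ℝ) : ℝ :=
  (∑ i ∈ Finset.range N, d i * frameDeriv L (i + 1) ξ) + α * (L ^ 2 * farT2Deriv L ξ)

variable {L : ℝ} (hL : 0 < L) (N : ℕ) (d : ℕ → ℝ) (α : ℝ)
include hL

/-- `Ω₁` is the derivative of `Ω`. [folklore] -/
theorem hasDerivAt_frameCentre (ξ : ℝ) : HasDerivAt (frameCentre L N d α) (frameCentreDeriv L N d α ξ) ξ := by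
  have h1 : HasDerivAt (fun ξ => ∑ i ∈ Finset.range N, d i * frame L (i + 1) ξ)
      (∑ i ∈ Finset.range N, d i * frameDeriv L (i + 1) ξ) ξ :=
    HasDerivAt.fun_sum fun i _ => (hasDerivAt_frame hL.ne' (i + 1) ξ).const_mul (d i)
  have h2 : HasDerivAt (fun ξ => α * (L ^ 2 * farT2 L ξ)) (α * (L ^ 2 * farT2Deriv L ξ)) ξ :=
    ((hasDerivAt_farT2 hL ξ).const_mul (L ^ 2)).const_mul α
  exact h1.add h2

/-- `Ω` is smooth. [folklore] -/
theorem contDiff_frameCentre {k : WithTop ℕ∞} : ContDiff ℝ k (frameCentre L N d α) := by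
  unfold frameCentre
  exact (ContDiff.sum fun i _ => contDiff_const.mul (contDiff_frame' L (i + 1))).add
    (contDiff_const.mul (contDiff_const.mul (contDiff_farT2 hL)))

/-- **`Ω₁ ∈ C^k`** for every `k` (hypothesis-ledger row #2). [folklore] -/
theorem contDiff_frameCentreDeriv {k : WithTop ℕ∞} : ContDiff ℝ k (frameCentreDeriv L N d α) := by
  unfold frameCentreDeriv
  exact (ContDiff.sum fun i _ => contDiff_const.mul (contDiff_frameDeriv hL.ne' (i + 1))).add
    (contDiff_const.mul (contDiff_const.mul (contDiff_farT2Deriv L)))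

omit hL in
/-- `Ω` is odd. [folklore] -/
theorem frameCentre_neg (ξ : ℝ) : frameCentre L N d α (-ξ) = -frameCentre L N d α ξ := by
  simp only [frameCentre, frame_neg', farT2_neg, mul_neg, Finset.sum_neg_distrib, neg_add]

omit hL in
/-- `Ω(0) = 0`. [folklore] -/
theorem frameCentre_zero : frameCentre L N d α 0 = 0 := by
  have h := frameCentre_neg N d α (L := L) 0
  rw [neg_zero] at h
  linarith

/-- **Pointwise bound** `|Ω(ξ)| ≤ (2L²·Σ|d_i| + |α|L²)/(L² + ξ²)`. [folklore] -/
theorem abs_frameCentre_le (ξ : ℝ) :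
    |frameCentre L N d α ξ| ≤ (2 * L ^ 2 * (∑ i ∈ Finset.range N, |d i|) + |α| * L ^ 2) / (L ^ 2 + ξ ^ 2) := by
  rw [frameCentre, add_div, Finset.mul_sum, Finset.sum_div]
  refine (abs_add_le _ _).trans (add_le_add ((Finset.abs_sum_le_sum_abs _ _).trans (Finset.sum_le_sum fun i _ => ?_)) ?_)
  · rw [abs_mul]
    calc |d i| * |frame L (i + 1) ξ| ≤ |d i| * (2 * L ^ 2 / (L ^ 2 + ξ ^ 2)) :=
          mul_le_mul_of_nonneg_left (abs_frame_le' hL.ne' _ ξ) (abs_nonneg _)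
      _ = 2 * L ^ 2 * |d i| / (L ^ 2 + ξ ^ 2) := by ring
  · rw [abs_mul]
    calc |α| * |L ^ 2 * farT2 L ξ| ≤ |α| * (L ^ 2 / (L ^ 2 + ξ ^ 2)) := mul_le_mul_of_nonneg_left (abs_farT2_le hL ξ) (abs_nonneg _)
      _ = |α| * L ^ 2 / (L ^ 2 + ξ ^ 2) := by ring

/-- **Pointwise bound** `|Ω₁(ξ)| ≤ (2L·Σ(2i + 3)|d_i| + 2L|α|)/(L² + ξ²)`. [folklore] -/
theorem abs_frameCentreDeriv_le (ξ : ℝ) :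
    |frameCentreDeriv L N d α ξ| ≤ (2 * L * (∑ i ∈ Finset.range N, (2 * (i + 1 : ℕ) + 1) * |d i|) + 2 * L * |α|) / (L ^ 2 + ξ ^ 2) := by
  rw [frameCentreDeriv, add_div, Finset.mul_sum, Finset.sum_div]
  refine (abs_add_le _ _).trans (add_le_add ((Finset.abs_sum_le_sum_abs _ _).trans (Finset.sum_le_sum fun i _ => ?_)) ?_)
  · rw [abs_mul]
    calc |d i| * |frameDeriv L (i + 1) ξ| ≤ |d i| * ((2 * (i + 1 : ℕ) + 1) * (2 * |L| / (L ^ 2 + ξ ^ 2))) :=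
          mul_le_mul_of_nonneg_left (abs_frameDeriv_le hL.ne' _ ξ) (abs_nonneg _)
      _ = 2 * L * ((2 * (i + 1 : ℕ) + 1) * |d i|) / (L ^ 2 + ξ ^ 2) := by rw [abs_of_pos hL]; ring
  · rw [abs_mul]
    calc |α| * |L ^ 2 * farT2Deriv L ξ| ≤ |α| * (2 * L / (L ^ 2 + ξ ^ 2)) := mul_le_mul_of_nonneg_left (abs_farT2Deriv_le hL ξ) (abs_nonneg _)
      _ = 2 * L * |α| / (L ^ 2 + ξ ^ 2) := by ring

/-- Weighted square-integrability from a bound `|g| ≤ C/(L² + ξ²)`: `∫ (L² + ξ²)g² < ∞`. [folklore] -/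
theorem integrable_weight_sq_of_le {g : ℝ → ℝ} (hg : Continuous g) {C : ℝ} (hC : ∀ ξ, |g ξ| ≤ C / (L ^ 2 + ξ ^ 2)) :
    Integrable fun ξ => (L ^ 2 + ξ ^ 2) * g ξ ^ 2 := by
  refine Integrable.mono' ((SheetRWeightedEmbeddings.integrable_inv_sq_add_sq hL).const_mul (C ^ 2))
    ((by fun_prop : Continuous fun ξ => (L ^ 2 + ξ ^ 2) * g ξ ^ 2).aestronglyMeasurable) (Eventually.of_forall fun ξ => ?_)
  have hw : 0 < L ^ 2 + ξ ^ 2 := by positivity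
  rw [Real.norm_eq_abs, abs_of_nonneg (by positivity)]
  have h1 : g ξ ^ 2 ≤ (C / (L ^ 2 + ξ ^ 2)) ^ 2 := by
    rw [← sq_abs (g ξ)]
    exact pow_le_pow_left₀ (abs_nonneg _) (hC ξ) 2
  calc (L ^ 2 + ξ ^ 2) * g ξ ^ 2 ≤ (L ^ 2 + ξ ^ 2) * (C / (L ^ 2 + ξ ^ 2)) ^ 2 := mul_le_mul_of_nonneg_left h1 hw.le
    _ = C ^ 2 * (L ^ 2 + ξ ^ 2)⁻¹ := by field_simp

/-! ### §4 The Hilbert transform of the frame centre -/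

omit hL in
/-- Additivity of the p.v. Hilbert transform over a finite sum of `C¹ ∩ L¹` functions. [folklore] -/
theorem hilbertTransform_finset_sum {ι : Type*} (s : Finset ι) (f : ι → ℝ → ℝ) (hf : ∀ i ∈ s, ContDiff ℝ 1 (f i))
    (hfi : ∀ i ∈ s, Integrable (f i)) (x : ℝ) :
    hilbertTransform (fun y => ∑ i ∈ s, f i y) x = ∑ i ∈ s, hilbertTransform (f i) x := by
  classical
  induction s using Finset.induction_on with
  | empty =>
    simp only [Finset.sum_empty]
    simp [hilbertTransform]
  | insert a s ha ih =>
    have hfs : ContDiff ℝ 1 (fun y => ∑ i ∈ s, f i y) := ContDiff.sum fun i hi => hf i (Finset.mem_insert_of_mem hi)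
    have hfis : Integrable (fun y => ∑ i ∈ s, f i y) := integrable_finsetSum _ fun i hi => hfi i (Finset.mem_insert_of_mem hi)
    rw [Finset.sum_insert ha]
    have hsum : (fun y => ∑ i ∈ insert a s, f i y) = fun y => f a y + ∑ i ∈ s, f i y := by
      funext y; rw [Finset.sum_insert ha]
    rw [hsum, hilbertTransform_add (integrableOn_symmIntegrand_of_contDiff (hf a (Finset.mem_insert_self a s))
      (hfi a (Finset.mem_insert_self a s)) x) (integrableOn_symmIntegrand_of_contDiff hfs hfis x),
      ih (fun i hi => hf i (Finset.mem_insert_of_mem hi)) (fun i hi => hfi i (Finset.mem_insert_of_mem hi))]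

/-- **`H Ω = −Σ d_i (1 + cos θ)cos((i+1)θ) + α·L²·H T₂`** (closed form; `H e_n` and `H T₂` from the tree). [folklore] -/
theorem hilbertTransform_frameCentre (x : ℝ) :
    hilbertTransform (frameCentre L N d α) x =
      -(∑ i ∈ Finset.range N, d i * ((1 + cos (2 * arctan (x / L))) * cos ((i + 1 : ℕ) * (2 * arctan (x / L)))))
        + α * (L ^ 2 * (2 / π * (x * Real.arsinh (x / L) / ((L ^ 2 + x ^ 2) * √(L ^ 2 + x ^ 2)) - (L ^ 2 + x ^ 2)⁻¹))) := by
  have hf1 : ContDiff ℝ 1 (fun y => ∑ i ∈ Finset.range N, d i * frame L (i + 1) y) :=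
    ContDiff.sum fun i _ => contDiff_const.mul (contDiff_frame' L (i + 1))
  have hfi1 : Integrable (fun y => ∑ i ∈ Finset.range N, d i * frame L (i + 1) y) :=
    integrable_finsetSum _ fun i _ => (integrable_frame hL (i + 1)).const_mul (d i)
  have hf2 : ContDiff ℝ 1 (fun y => α * (L ^ 2 * farT2 L y)) := contDiff_const.mul (contDiff_const.mul (contDiff_farT2 hL))
  have hfi2 : Integrable (fun y => α * (L ^ 2 * farT2 L y)) := ((integrable_farFieldT2 hL).const_mul _).const_mul _
  have hsplit : frameCentre L N d α = fun y => (fun y => ∑ i ∈ Finset.range N, d i * frame L (i + 1) y) y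
      + (fun y => α * (L ^ 2 * farT2 L y)) y := by
    funext y; rfl
  rw [hsplit, hilbertTransform_add (f := fun y => ∑ i ∈ Finset.range N, d i * frame L (i + 1) y)
      (g := fun y => α * (L ^ 2 * farT2 L y)) (integrableOn_symmIntegrand_of_contDiff hf1 hfi1 x)
      (integrableOn_symmIntegrand_of_contDiff hf2 hfi2 x),
    hilbertTransform_finset_sum (Finset.range N) (fun i y => d i * frame L (i + 1) y)
      (fun i _ => contDiff_const.mul (contDiff_frame' L (i + 1))) (fun i _ => (integrable_frame hL (i + 1)).const_mul (d i)) x]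
  congr 1
  · rw [← Finset.sum_neg_distrib]
    refine Finset.sum_congr rfl fun i _ => ?_
    rw [hilbertTransform_const_mul, show frame L (i + 1) = fun ξ => (1 + cos (2 * arctan (ξ / L))) * sin ((i + 1 : ℕ) * (2 * arctan (ξ / L)))
      from rfl, hilbertTransform_frame hL (Nat.succ_ne_zero i)]
    ring
  · rw [hilbertTransform_const_mul, hilbertTransform_const_mul, show farT2 L = fun y => y / ((L ^ 2 + y ^ 2) * √(L ^ 2 + y ^ 2)) from rfl,
      hilbertTransform_farFieldT2 hL]

omit hL in
/-- `|arsinh t| ≤ |t|` (`x ≤ sinh x` for `x ≥ 0`, oddness). [folklore] -/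
theorem abs_arsinh_le (t : ℝ) : |Real.arsinh t| ≤ |t| := by
  have key : ∀ s : ℝ, 0 ≤ s → Real.arsinh s ≤ s := fun s hs => by
    have h := Real.self_le_sinh_iff.2 (Real.arsinh_nonneg_iff.2 hs)
    rwa [Real.sinh_arsinh] at h
  rcases le_total 0 t with ht | ht
  · rw [abs_of_nonneg (Real.arsinh_nonneg_iff.2 ht), abs_of_nonneg ht]; exact key t ht
  · have h1 := key (-t) (neg_nonneg.2 ht)
    rw [Real.arsinh_neg] at h1
    have h2 : Real.arsinh t ≤ 0 := by
      have := Real.arsinh_le_arsinh.2 ht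
      rwa [Real.arsinh_zero] at this
    rw [abs_of_nonpos h2, abs_of_nonpos ht]; linarith

/-- **Bound on `H T₂`**: `|L²·H T₂(x)| ≤ 6/π`. [folklore] -/
theorem abs_hilbert_farT2_le (x : ℝ) :
    |L ^ 2 * (2 / π * (x * Real.arsinh (x / L) / ((L ^ 2 + x ^ 2) * √(L ^ 2 + x ^ 2)) - (L ^ 2 + x ^ 2)⁻¹))| ≤ 6 / π := by
  have hL0 : L ≠ 0 := hL.ne'
  have hw : 0 < L ^ 2 + x ^ 2 := by positivity
  have hs : 0 < √(L ^ 2 + x ^ 2) := Real.sqrt_pos.2 hw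
  have hLs : L ≤ √(L ^ 2 + x ^ 2) := by
    calc L = √(L ^ 2) := (Real.sqrt_sq hL.le).symm
      _ ≤ √(L ^ 2 + x ^ 2) := Real.sqrt_le_sqrt (by nlinarith)
  -- first term: |x·arsinh(x/L)| ≤ x²/L ≤ (L² + x²)/L
  have h1 : |x * Real.arsinh (x / L) / ((L ^ 2 + x ^ 2) * √(L ^ 2 + x ^ 2))| ≤ 1 / L ^ 2 := by
    rw [abs_div, abs_of_pos (by positivity : (0:ℝ) < (L ^ 2 + x ^ 2) * √(L ^ 2 + x ^ 2)), div_le_div_iff₀ (by positivity) (by positivity),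
      one_mul, abs_mul]
    have ha : |Real.arsinh (x / L)| ≤ |x| / L := by
      have := abs_arsinh_le (x / L); rwa [abs_div, abs_of_pos hL] at this
    calc |x| * |Real.arsinh (x / L)| * L ^ 2 ≤ |x| * (|x| / L) * L ^ 2 := by gcongr
      _ = x ^ 2 * L := by rw [← sq_abs x]; field_simp
      _ ≤ (L ^ 2 + x ^ 2) * L := by nlinarith [sq_nonneg L, hL]
      _ ≤ (L ^ 2 + x ^ 2) * √(L ^ 2 + x ^ 2) := mul_le_mul_of_nonneg_left hLs hw.le
  have h2 : |(L ^ 2 + x ^ 2)⁻¹| ≤ 1 / L ^ 2 := by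
    rw [abs_of_pos (inv_pos.2 hw), one_div]
    exact inv_anti₀ (by positivity) (by nlinarith)
  have hπ : 0 < π := Real.pi_pos
  rw [abs_mul, abs_of_pos (by positivity : (0:ℝ) < L ^ 2), abs_mul, abs_of_pos (by positivity : (0:ℝ) < 2 / π)]
  calc L ^ 2 * (2 / π * |x * Real.arsinh (x / L) / ((L ^ 2 + x ^ 2) * √(L ^ 2 + x ^ 2)) - (L ^ 2 + x ^ 2)⁻¹|)
      ≤ L ^ 2 * (2 / π * (1 / L ^ 2 + 1 / L ^ 2)) := by
        gcongr
        exact (abs_sub _ _).trans (add_le_add h1 h2)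
    _ = 4 / π := by field_simp; ring
    _ ≤ 6 / π := by gcongr; norm_num

/-- **Hilbert bound** `|H Ω(x)| ≤ 2·Σ|d_i| + 6|α|/π`. [folklore] -/
theorem abs_hilbertTransform_frameCentre_le (x : ℝ) :
    |hilbertTransform (frameCentre L N d α) x| ≤ 2 * (∑ i ∈ Finset.range N, |d i|) + 6 * |α| / π := by
  rw [hilbertTransform_frameCentre hL N d α x]
  refine (abs_add_le _ _).trans (add_le_add ?_ ?_)
  · rw [abs_neg, Finset.mul_sum]
    refine (Finset.abs_sum_le_sum_abs _ _).trans (Finset.sum_le_sum fun i _ => ?_)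
    rw [abs_mul]
    have hc := abs_coframe_le hL.ne' (i + 1) x
    have h2 : 2 * L ^ 2 / (L ^ 2 + x ^ 2) ≤ 2 := by
      rw [div_le_iff₀ (by positivity)]; nlinarith [sq_nonneg x]
    calc |d i| * |(1 + cos (2 * arctan (x / L))) * cos ((i + 1 : ℕ) * (2 * arctan (x / L)))| ≤ |d i| * 2 :=
          mul_le_mul_of_nonneg_left (hc.trans h2) (abs_nonneg _)
      _ = 2 * |d i| := mul_comm _ _
  · rw [abs_mul]
    calc |α| * |L ^ 2 * (2 / π * (x * Real.arsinh (x / L) / ((L ^ 2 + x ^ 2) * √(L ^ 2 + x ^ 2)) - (L ^ 2 + x ^ 2)⁻¹))|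
        ≤ |α| * (6 / π) := mul_le_mul_of_nonneg_left (abs_hilbert_farT2_le hL x) (abs_nonneg _)
      _ = 6 * |α| / π := by ring

/-! ### §5 The frame centre is a centre -/

/-- **A FINITE FRAME COMBINATION PLUS `α·L²T₂` IS A CENTRE**: `IsCentre L Ω Ω₁ H₀` for `Ω = Σ_{i<N} d_i e_{i+1} + αL²T₂`,
`Ω₁` its derivative, `H₀ = 2Σ|d_i| + 6|α|/π` — primitive form, oddness, measurability, `∫(L²+ξ²)Ω² < ∞`, `∫(L²+ξ²)Ω₁² < ∞`,
`|HΩ| ≤ H₀`.  With the coefficients of record (data file) this is hypothesis-ledger row #1 of the Z3-SR chain as a kernel fact. [folklore] -/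
theorem isCentre_frameCentre :
    IsCentre L (frameCentre L N d α) (frameCentreDeriv L N d α) (2 * (∑ i ∈ Finset.range N, |d i|) + 6 * |α| / π) where
  primitive x := by
    have hcont : Continuous (frameCentreDeriv L N d α) := (contDiff_frameCentreDeriv hL N d α (k := 0)).continuous
    rw [intervalIntegral.integral_eq_sub_of_hasDerivAt (fun t _ => hasDerivAt_frameCentre hL N d α t) (hcont.intervalIntegrable _ _),
      frameCentre_zero N d α, sub_zero]
  odd := frameCentre_neg N d α
  measurable := (contDiff_frameCentreDeriv hL N d α (k := 0)).continuous.aestronglyMeasurable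
  weight₀ := integrable_weight_sq_of_le hL (contDiff_frameCentre hL N d α (k := 0)).continuous (abs_frameCentre_le hL N d α)
  weight₁ := integrable_weight_sq_of_le hL (contDiff_frameCentreDeriv hL N d α (k := 0)).continuous (abs_frameCentreDeriv_le hL N d α)
  hilbert_le := abs_hilbertTransform_frameCentre_le hL N d α

/-- `deriv Ω = Ω₁`. [folklore] -/
theorem deriv_frameCentre : deriv (frameCentre L N d α) = frameCentreDeriv L N d α :=
  funext fun ξ => (hasDerivAt_frameCentre hL N d α ξ).deriv

end SheetRFrameCentre
end Summit.NavierStokesRegularity.OSWSelfSimilar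

end
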